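import Literature.NumberTheory.LFunctions.Zhang2022.Section12Top1522Int
import Literature.NumberTheory.LFunctions.Zhang2022.Section12Eq1216Closer

/-!
# Zhang (2022) §12 p. 73: the node `Top1522Ex` and the leaf (12.16) from the EVAL half of u049 alone

Topic `Literature/NumberTheory/LFunctions/Zhang2022` (Landau–Siegel audit tree; verdict-neutral).
Y. Zhang, *Discrete mean estimates and the Landau–Siegel zero*, arXiv:2211.02515v1 (2022)
[Zhang2022LandauSiegel]. **Status of the source: an unrefereed manuscript under adjudication**; everything in this
file is PROVED (theorems only; no new definitions, no new facts); nothing here is a claim about Theorems 1–2 of the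
source or about Landau–Siegel zeros.

Glue for the RT-02 node `Typed.Sec12C.Top1522Ex` (§12.u049 in the exact reading, p. 73, tex L3694–L3702): the printed
display has two equalities, `S_j|_{P″₁<dr<P₂}(𝐚₁₅,𝐚₂₂) = main12u049sumEx + o(α)` (FIRST, the `n`-sum: "by lemma 8.2, 8.3
and 12.3 [8.4, 12.1]", the EVAL half) and `main12u049sumEx = main12u049intEx + o(α)` (SECOND, sum → integral, the INT
half — a THEOREM: `main12u049sumEx_sub_intEx`, `Section12Top1522Int`). Hence:

* **`top1522Ex_of_eval`** — the node `Top1522Ex c′` follows from its EVAL half alone (stated inline, verbatim the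
  binder shape of the node with `main12u049sumEx` in place of `main12u049intEx`);
* **`eq1216_of_eval`** — so does the leaf (12.16) `Eq1216 c′` (`Sec12D.eq1216_of_top1522Ex`, p476025).

What remains OPEN for hTop22Ex/h1216 after this file: exactly the EVAL half (owner zl-w12-p9; M-layer = `U020_holds`
for the `ϰ₁₃`-sum, Lemma 8.4 (rel.) for the `ξ₀ⱼ`-sum, re-indexing `n = dr` by (8.10)).

## References

* Y. Zhang, arXiv:2211.02515v1 (2022), §12 p. 73 (u049, (12.16)). [cite: Zhang2022LandauSiegel, §12 (12.16) p.73]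
-/

noncomputable section

open Complex Real ComplexConjugate
open Literature.NumberTheory.LFunctions.Zhang2022
open Literature.NumberTheory.LFunctions.Zhang2022.Skeleton

namespace Literature.NumberTheory.LFunctions.Zhang2022.Typed.Sec12C

variable (c' : ℝ)

/-- **`Top1522Ex` from its EVAL half** (the first printed equality of u049, `n`-sum form, exact weight): the second
equality is the theorem `main12u049sumEx_sub_intEx`; `ε/2 + ε/2`. [cite: Zhang2022LandauSiegel, §12 (12.16) p.73] -/
theorem top1522Ex_of_eval
    (hEval : ∀ ε : ℝ, 0 < ε → ForAllLarge fun D _ χ => AssumptionA D χ →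
      ∀ a15 : ℕ → ℂ, (∀ n, a15 n = χ (n : ZMod D) * vk13 D n) →
        ∀ j ∈ ({1, 2, 3} : Finset ℕ),
          ‖SjOn c' D j a15 (a22 χ) (rngTop D) - main12u049sumEx c' χ j‖ ≤ ε * alpha D) :
    Top1522Ex c' := by
  intro ε hε
  have hε2 : 0 < ε / 2 := by positivity
  refine ((hEval (ε / 2) hε2).and (main12u049sumEx_sub_intEx c' (ε / 2) hε2)).mono ?_
  intro D _ χ _ _ ⟨hE, hI⟩ hA a15 ha15 j hj
  have h1 := hE hA a15 ha15 j hj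
  have h2 := hI j hj
  calc ‖SjOn c' D j a15 (a22 χ) (rngTop D) - main12u049intEx c' χ j‖
      = ‖(SjOn c' D j a15 (a22 χ) (rngTop D) - main12u049sumEx c' χ j) +
          (main12u049sumEx c' χ j - main12u049intEx c' χ j)‖ := by congr 1; ring
    _ ≤ ‖SjOn c' D j a15 (a22 χ) (rngTop D) - main12u049sumEx c' χ j‖ +
          ‖main12u049sumEx c' χ j - main12u049intEx c' χ j‖ := norm_add_le _ _
    _ ≤ ε / 2 * alpha D + ε / 2 * alpha D := add_le_add h1 h2
    _ = ε * alpha D := by ring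

/-- **(12.16) from the EVAL half of u049** (`top1522Ex_of_eval` ∘ `Sec12D.eq1216_of_top1522Ex`).
[cite: Zhang2022LandauSiegel, §12 (12.16) p.73] -/
theorem eq1216_of_eval
    (hEval : ∀ ε : ℝ, 0 < ε → ForAllLarge fun D _ χ => AssumptionA D χ →
      ∀ a15 : ℕ → ℂ, (∀ n, a15 n = χ (n : ZMod D) * vk13 D n) →
        ∀ j ∈ ({1, 2, 3} : Finset ℕ),
          ‖SjOn c' D j a15 (a22 χ) (rngTop D) - main12u049sumEx c' χ j‖ ≤ ε * alpha D) :
    Eq1216 c' :=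
  Sec12D.eq1216_of_top1522Ex c' (top1522Ex_of_eval c' hEval)

end Literature.NumberTheory.LFunctions.Zhang2022.Typed.Sec12C
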